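import Mathlib
import Summits.AtomisticToContinuum.Crystallization.Theses.PhononSlackCertificates

/-!
# Route `PhononSlackCertificates`, crux `NearFieldConvexity` (stmt-AtomisticToContinuum-13958), line `Sketch`:
stub `stub_tubeCount`

TUBE COUNT: `r`-separated points of `ℝ³` within `ρ` of a segment `{p + t u : 0 ≤ t ≤ L}` (`‖u‖ = 1`)
number at most `(L/ρ + 2)(4ρ/r + 1)³`: every such point is within `2ρ` of one of the points
`p + (m ρ) u`, `m = 0, …, ⌊L/ρ⌋`, and each of these `⌊L/ρ⌋ + 1 ≤ L/ρ + 2` balls holds at most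
`(4ρ/r + 1)³` points by the volume packing bound `card_le_of_separated_of_dist_le`.

The file also carries the elementary helper lemmas of the sibling stub `stub_pairCountOfCrossing`
(prefixed `pairCount_`): `Nat.card` bookkeeping, the `171/200`-separation of good particles, the
ball count of particle indices, the tube witness of a crossing pair, and two segment facts.
-/

noncomputable section

open scoped BigOperators InnerProductSpace
open Literature.MathematicalPhysics.StatisticalMechanics Literature.Geometry.DiscreteGeometry

namespace Summit.AtomisticToContinuum.Crystallization.Theorems.PhononSlackNearFieldConvexity

/-! ### Helper lemmas for the pair count (`stub_pairCountOfCrossing`), carried by this file -/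

/-- `Nat.card` of a subtype cut out of a finset is the card of the filter. [folklore] -/
theorem pairCount_natCard_eq {N : ℕ} (Ω : Finset (Fin N)) (p : Fin N → Prop) [DecidablePred p] :
    (Nat.card {i : Fin N // i ∈ Ω ∧ p i} : ℝ) = ((Ω.filter p).card : ℝ) := by
  rw [Nat.card_eq_fintype_card, Fintype.card_subtype]
  congr 2
  ext i
  simp [Finset.mem_filter]

/-- A `1/20`-good particle (window `[47/50, 1]`) is at distance `≥ 171/200` from every other particle:
inside `3a/2` the other particle is a matched pattern site at distance `≥ a − a/20 ≥ 0.893`, outside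
it is farther than `3a/2 ≥ 1.41`. [folklore] -/
theorem pairCount_sep_of_good {N : ℕ} (x : Fin N → EuclideanSpace ℝ (Fin 3)) {i : Fin N}
    (hi : IsTwoShellGood (1 / 20) (47 / 50) 1 x i) (k : Fin N) (hk : k ≠ i) :
    171 / 200 ≤ dist (x i) (x k) := by
  obtain ⟨a, ha1, ha2, A, P, f, hP, hf, -, hall⟩ := hi
  by_cases hd : dist (x k) (x i) ≤ 3 / 2 * a
  · obtain ⟨v, hv, rfl⟩ := hall k hk hd
    have hv1 : 1 ≤ ‖v‖ := by
      have h2 : (1 : ℝ) ≤ Real.sqrt 2 := Real.one_le_sqrt.2 (by norm_num)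
      rcases hP with rfl | rfl
      · rcases norm_of_mem_fccTwoShellPattern hv with h | h <;> rw [h]; exact h2
      · rcases norm_of_mem_hcpTwoShellPattern hv with h | h <;> rw [h]; exact h2
    have hfv := (hf v hv).2
    have hAv : a ≤ ‖a • A v‖ := by
      rw [norm_smul, Real.norm_of_nonneg (by linarith), A.norm_map]
      nlinarith
    have htri : ‖a • A v‖ ≤ dist (x (f v)) (x i + a • A v) + dist (x (f v)) (x i) := by
      have h := dist_triangle (x i + a • A v) (x (f v)) (x i)
      rw [dist_comm (x i + a • A v) (x (f v))] at h
      have h' : dist (x i + a • A v) (x i) = ‖a • A v‖ := by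
        rw [dist_eq_norm, add_sub_cancel_left]
      linarith
    rw [dist_comm]
    linarith
  · push Not at hd
    rw [dist_comm]
    linarith

/-- Ball count of particle indices: an `r`-separated set of particles within `R` of a point has at
most `(2R/r + 1)³` members. [folklore] -/
theorem pairCount_card_ball {N : ℕ} (x : Fin N → EuclideanSpace ℝ (Fin 3)) (S : Finset (Fin N))
    {r : ℝ} (hr : 0 < r) (hsep : ∀ i ∈ S, ∀ j ∈ S, i ≠ j → r ≤ dist (x i) (x j))
    (p : EuclideanSpace ℝ (Fin 3)) {R : ℝ} (hR : 0 ≤ R) (hS : ∀ i ∈ S, dist (x i) p ≤ R) :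
    (S.card : ℝ) ≤ (2 * R / r + 1) ^ 3 := by
  classical
  have hinj : Set.InjOn x ↑S := by
    intro i hi j hj hij
    by_contra hne
    have h := hsep i hi j hj hne
    rw [hij, dist_self] at h
    linarith
  have h1 : ∀ c ∈ S.image x, dist c p ≤ R := by
    intro c hc
    obtain ⟨i, hi, rfl⟩ := Finset.mem_image.1 hc
    exact hS i hi
  have h2 : ∀ c ∈ S.image x, ∀ d ∈ S.image x, c ≠ d → r ≤ dist c d := by
    intro c hc d hd hcd
    obtain ⟨i, hi, rfl⟩ := Finset.mem_image.1 hc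
    obtain ⟨j, hj, rfl⟩ := Finset.mem_image.1 hd
    exact hsep i hi j hj fun h => hcd (by rw [h])
  have h := card_le_of_separated_of_dist_le (S.image x) p hr hR h1 h2
  rwa [finrank_euclideanSpace_fin, Finset.card_image_of_injOn hinj] at h

/-- **Tube witness.**  If a point `y = p + t (q − p)` (`0 ≤ t ≤ 1`) of the segment `[p, q]`,
`|p − q| ≥ 4`, is within `1` of `b`, and `q` is at most as far from `b` as `p` is
(`|q − b| ≤ |p − b|`), then `q` lies within `4` of the ray from `p` through `b`, at a parameter in
`[0, 4 |p − b|]` (indeed `t ≥ 1/4` and `q − (p + t⁻¹(b − p)) = t⁻¹ (y − b)`). [folklore] -/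
theorem pairCount_tube_witness {p q b : EuclideanSpace ℝ (Fin 3)} {t : ℝ} (ht0 : 0 ≤ t)
    (ht1 : t ≤ 1) (hr : 4 ≤ dist p q) (hyb : dist b (p + t • (q - p)) ≤ 1)
    (hsu : dist q b ≤ dist p b) :
    ∃ lam : ℝ, 0 ≤ lam ∧ lam ≤ 4 * dist p b ∧
      dist q (p + lam • ((dist p b)⁻¹ • (b - p))) ≤ 4 := by
  set r := dist p q with hr_def
  set s := dist p b with hs_def
  set y : EuclideanSpace ℝ (Fin 3) := p + t • (q - p) with hy_def
  -- `s ≥ r/2`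
  have hsr : r ≤ s + dist q b := by
    have := dist_triangle p b q
    rwa [dist_comm b q] at this
  have hs2 : r / 2 ≤ s := by linarith
  have hs0 : 0 < s := by linarith
  -- `t r = |y − p| ≥ s − 1`, hence `t ≥ 1/4`
  have hyp : dist y p = t * r := by
    rw [hy_def, dist_eq_norm, add_sub_cancel_left, norm_smul, Real.norm_of_nonneg ht0, ← dist_eq_norm,
      dist_comm, hr_def]
  have hst : s ≤ t * r + 1 := by
    have := dist_triangle p y b
    rw [dist_comm p y, hyp, dist_comm y b] at this
    linarith
  have ht4 : 1 / 4 ≤ t := by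
    by_contra h
    push Not at h
    have : t * r < r / 4 := by nlinarith
    linarith
  have htpos : 0 < t := by linarith
  refine ⟨t⁻¹ * s, by positivity, ?_, ?_⟩
  · rw [← div_eq_inv_mul, div_le_iff₀ htpos]
    nlinarith
  · -- the centre `p + t⁻¹ (b − p)` and `q − centre = t⁻¹ (y − b)`
    have hc : p + (t⁻¹ * s) • ((dist p b)⁻¹ • (b - p)) = p + t⁻¹ • (b - p) := by
      rw [smul_smul, ← hs_def, mul_assoc, mul_inv_cancel₀ hs0.ne', mul_one]
    rw [hc, dist_eq_norm]
    have hq : q - (p + t⁻¹ • (b - p)) = t⁻¹ • (y - b) := by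
      have h1 : y - b = t • (q - p) - (b - p) := by rw [hy_def]; abel
      rw [h1, smul_sub (t⁻¹) (t • (q - p)) (b - p), smul_smul, inv_mul_cancel₀ htpos.ne', one_smul]
      abel
    rw [hq, norm_smul, norm_inv, Real.norm_of_nonneg ht0, ← dist_eq_norm, dist_comm]
    calc t⁻¹ * dist b y ≤ t⁻¹ * 1 := mul_le_mul_of_nonneg_left hyb (inv_nonneg.2 ht0)
      _ ≤ 4 := by rw [mul_one, inv_le_comm₀ htpos (by norm_num)]; linarith

/-- Reparametrising a segment from the other end. [folklore] -/
theorem pairCount_segment_symm (p q : EuclideanSpace ℝ (Fin 3)) (t : ℝ) :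
    q + (1 - t) • (p - q) = p + t • (q - p) := by
  rw [sub_smul, one_smul, smul_sub, smul_sub]
  abel

/-- The bound of one end of a crossing pair by the scale: if `y = p + t (q − p)`, `0 ≤ t ≤ 1`,
`|p − q| < 2ℓ` and `dist b y ≤ 1` then `dist p b < 2ℓ + 1`. [folklore] -/
theorem pairCount_near_of_cross {p q b : EuclideanSpace ℝ (Fin 3)} {t ℓ : ℝ} (ht0 : 0 ≤ t)
    (ht1 : t ≤ 1) (hr : dist p q < 2 * ℓ) (hyb : dist b (p + t • (q - p)) ≤ 1) :
    dist p b < 2 * ℓ + 1 := by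
  set y : EuclideanSpace ℝ (Fin 3) := p + t • (q - p) with hy
  have hyp : dist p y = t * dist p q := by
    rw [hy, dist_comm, dist_eq_norm, add_sub_cancel_left, norm_smul, Real.norm_of_nonneg ht0,
      ← dist_eq_norm, dist_comm]
  have h1 : dist p b ≤ dist p y + dist y b := dist_triangle _ _ _
  rw [hyp, dist_comm y b] at h1
  have h2 : t * dist p q ≤ dist p q := by
    have := mul_le_mul_of_nonneg_right ht1 (dist_nonneg (x := p) (y := q))
    rwa [one_mul] at this
  linarith

/-- **Stub (geometry): TUBE COUNT.**  `r`-separated points within `ρ` of a segment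
`{p + t u : 0 ≤ t ≤ L}` (`‖u‖ = 1`) number at most `(L/ρ + 2)(4ρ/r + 1)³` (cover by the balls
`B(p + mρ·u, 2ρ)`, `m = 0, …, ⌊L/ρ⌋ + 1`, and the ball packing bound). -/
theorem stub_tubeCount :
    ∀ (s : Finset (EuclideanSpace ℝ (Fin 3))) (p u : EuclideanSpace ℝ (Fin 3)) (r ρ L : ℝ),
      0 < r → 0 < ρ → 0 ≤ L → ‖u‖ = 1 → (∀ c ∈ s, ∃ t : ℝ, 0 ≤ t ∧ t ≤ L ∧ dist c (p + t • u) ≤ ρ) →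
      (∀ c ∈ s, ∀ d ∈ s, c ≠ d → r ≤ dist c d) →
        (s.card : ℝ) ≤ (L / ρ + 2) * (4 * ρ / r + 1) ^ 3 := by
  intro s p u r ρ L hr hρ hL hu hs hsep
  classical
  set M : ℕ := ⌊L / ρ⌋₊ with hM
  -- the covering balls
  set S : ℕ → Finset (EuclideanSpace ℝ (Fin 3)) :=
    fun m => s.filter (fun c => dist c (p + ((m : ℝ) * ρ) • u) ≤ 2 * ρ) with hS
  have hcover : s ⊆ (Finset.range (M + 1)).biUnion S := by
    intro c hc
    obtain ⟨t, ht0, htL, hct⟩ := hs c hc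
    set m : ℕ := ⌊t / ρ⌋₊ with hm
    have hm0 : (m : ℝ) ≤ t / ρ := Nat.floor_le (div_nonneg ht0 hρ.le)
    have hm1 : t / ρ < m + 1 := Nat.lt_floor_add_one _
    have hmM : m ≤ M := Nat.floor_le_floor (div_le_div_of_nonneg_right htL hρ.le)
    refine Finset.mem_biUnion.2 ⟨m, Finset.mem_range.2 (Nat.lt_succ_of_le hmM), ?_⟩
    refine Finset.mem_filter.2 ⟨hc, ?_⟩
    have hdiff : dist (p + t • u) (p + ((m : ℝ) * ρ) • u) ≤ ρ := by
      rw [dist_eq_norm, add_sub_add_left_eq_sub, ← sub_smul, norm_smul, hu, mul_one,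
        Real.norm_eq_abs, abs_le]
      constructor
      · have : (m : ℝ) * ρ ≤ t := by rwa [le_div_iff₀ hρ] at hm0
        linarith
      · have : t < ((m : ℝ) + 1) * ρ := by rwa [div_lt_iff₀ hρ] at hm1
        linarith
    calc dist c (p + ((m : ℝ) * ρ) • u) ≤ dist c (p + t • u) + dist (p + t • u) (p + ((m : ℝ) * ρ) • u) :=
          dist_triangle _ _ _
      _ ≤ ρ + ρ := add_le_add hct hdiff
      _ = 2 * ρ := by ring
  -- each ball holds few points
  have hball : ∀ m : ℕ, ((S m).card : ℝ) ≤ (4 * ρ / r + 1) ^ 3 := by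
    intro m
    have h1 : ∀ c ∈ S m, dist c (p + ((m : ℝ) * ρ) • u) ≤ 2 * ρ := fun c hc =>
      (Finset.mem_filter.1 hc).2
    have h2 : ∀ c ∈ S m, ∀ d ∈ S m, c ≠ d → r ≤ dist c d := fun c hc d hd hcd =>
      hsep c (Finset.mem_filter.1 hc).1 d (Finset.mem_filter.1 hd).1 hcd
    have h := card_le_of_separated_of_dist_le (S m) (p + ((m : ℝ) * ρ) • u) hr (by positivity) h1 h2
    rw [finrank_euclideanSpace_fin] at h
    calc ((S m).card : ℝ) ≤ (2 * (2 * ρ) / r + 1) ^ 3 := h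
      _ = (4 * ρ / r + 1) ^ 3 := by ring
  -- count
  have hcard : (s.card : ℝ) ≤ ∑ m ∈ Finset.range (M + 1), ((S m).card : ℝ) := by
    have h := (Finset.card_le_card hcover).trans Finset.card_biUnion_le
    exact_mod_cast h
  have hsum : ∑ m ∈ Finset.range (M + 1), ((S m).card : ℝ) ≤ (M + 1 : ℝ) * (4 * ρ / r + 1) ^ 3 := by
    calc ∑ m ∈ Finset.range (M + 1), ((S m).card : ℝ)
        ≤ ∑ _m ∈ Finset.range (M + 1), (4 * ρ / r + 1) ^ 3 := Finset.sum_le_sum fun m _ => hball m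
      _ = (M + 1 : ℝ) * (4 * ρ / r + 1) ^ 3 := by
          rw [Finset.sum_const, Finset.card_range, nsmul_eq_mul]
          push_cast
          ring
  have hM1 : (M : ℝ) ≤ L / ρ := Nat.floor_le (div_nonneg hL hρ.le)
  have hpos : 0 ≤ (4 * ρ / r + 1) ^ 3 := by positivity
  calc (s.card : ℝ) ≤ (M + 1 : ℝ) * (4 * ρ / r + 1) ^ 3 := hcard.trans hsum
    _ ≤ (L / ρ + 2) * (4 * ρ / r + 1) ^ 3 := mul_le_mul_of_nonneg_right (by linarith) hpos

end Summit.AtomisticToContinuum.Crystallization.Theorems.PhononSlackNearFieldConvexity
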